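import Summits.AnomalousDissipation.AnomalousDissipation.Theorems.ImpulseGridGridInjectionIdentity
import Literature.Analysis.FluidPDE.TimeAverageMeasureExistence

/-!
# Route ImpulseGrid (AnomalousDissipation) — stub W4 `stub_acWorkOfQuadratureDrag` of the line
# `Sketch` (crux `GridThesis`, item stmt-AnomalousDissipation-1770)

Sorry-free discharge of the registered stub `stub_acWorkOfQuadratureDrag` of the lead's skeleton for
the crux `Summit.AnomalousDissipation.AnomalousDissipation.Theses.ImpulseGrid.GridThesis` (line
`Sketch`), over the landed route files `ImpulseGridMeanMomentumBalance` (sup bound on the tested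
momentum, `impulseGrid_abs_integral_inner_le`) and `ImpulseGridGridInjectionIdentity` (interval
integrability of the pairings `GridInjection.intervalIntegrable_inner(_convect)` and additivity of
generalized long-time averages `GridInjection.longTimeAvg_add`).

**Statement.** Assume the α-balance (the neighbouring stub `stub_alphaBalance`, taken here as the
first hypothesis): for every steady smooth force `f`, every smooth divergence-free Stokes eigenfield
`G` (`ΔG = −λG`), every global Leray–Hopf solution `u` with sup-bounded kinetic energy and every
generalized limit `Λ`, `(f,G)·Λ⟨(G,u)⟩ = νλ·Λ⟨(G,u)²⟩ − Λ⟨(G,u)·T_G(u)⟩` with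
`T_G(u) = ∫⟪u,(u·∇)G⟫`. Then for a quadrature pair of smooth divergence-free Stokes eigenfields
`C, S` with the same eigenvalue `μ`, `νμ ≥ 0`, `(f,C) = κ > 0`, `(f,S) = 0`, and AC eddy drag
`Λ⟨X·T_C(u) + Y·T_S(u)⟩ ≤ −δ` (`X = (C,u)`, `Y = (S,u)`), one has `Λ⟨X⟩ ≥ δ/κ`.

**Proof.** The two balances read `κΛ⟨X⟩ = νμΛ⟨X²⟩ − Λ⟨X·T_C⟩` and `0 = νμΛ⟨Y²⟩ − Λ⟨Y·T_S⟩`.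
The products `X·T_C`, `Y·T_S` are integrable on every `(0, T]` (`T_C` is, by the flux bookkeeping
`GridInjection.intervalIntegrable_inner_convect`; `X` is measurable there and bounded on `[0, ∞)`
by the sup-energy bound, `impulseGrid_abs_integral_inner_le`; Mathlib `Integrable.bdd_mul`), so
`Λ⟨·⟩` is additive on them (`GridInjection.longTimeAvg_add`); `Λ⟨X²⟩, Λ⟨Y²⟩ ≥ 0` by positivity
of generalized limits on bounded non-negative functions (`GeneralizedLimit.longTimeAvg_nonneg`).
Summing, `κΛ⟨X⟩ = νμ(Λ⟨X²⟩ + Λ⟨Y²⟩) − Λ⟨X·T_C + Y·T_S⟩ ≥ δ`, and `κ > 0`.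

References: Foias–Manley–Rosa–Temam, *Navier–Stokes Equations and Turbulence* (CUP 2001),
Ch. IV §1.3 (calculus of generalized limits); Doering–Foias, JFM 467 (2002) §2.

No new definitions.
-/

noncomputable section

-- `Summit.<Summit>.<Problem>` is the tree's mandated summit-side namespace (CONVENTIONS §2); for this
-- single-conjunct summit the two coincide, so the duplicate is deliberate.
set_option linter.dupNamespace false

open MeasureTheory Set Filter Topology
open scoped InnerProductSpace RealInnerProductSpace

namespace Summit.AnomalousDissipation.AnomalousDissipation.Theorems

open Literature.Analysis.FluidPDE Literature.Analysis.FluidPDE.Torus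
open Literature.Analysis.FunctionSpaces Literature.Analysis.FunctionSpaces.Torus

namespace AcWorkOfQuadratureDrag

variable {ν : ℝ} {f G u₀ : UnitAddTorus (Fin 3) → EuclideanSpace ℝ (Fin 3)}
  {u : ℝ → UnitAddTorus (Fin 3) → EuclideanSpace ℝ (Fin 3)}

/-- The modal amplitude `t ↦ (G, u(t))` of a global Leray–Hopf solution with sup-bounded kinetic
energy, against a continuous field `G`, is bounded on `[0, ∞)`. [folklore] -/
theorem exists_abs_integral_inner_le (hu : IsGlobalLerayHopf ν (fun _ => f) u₀ u)
    (hG : Continuous G) (hE : ∃ C₀ : ℝ, ∀ t : ℝ, 0 ≤ t → kineticEnergy (u t) ≤ C₀) :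
    ∃ M : ℝ, ∀ t : ℝ, 0 ≤ t → |∫ x, ⟪G x, u t x⟫| ≤ M := by
  obtain ⟨C₀, hC₀⟩ := hE
  obtain ⟨K, hK0, hK⟩ := exists_nonneg_forall_norm_le_of_continuous hG
  refine ⟨K * (2⁻¹ * (1 + 2 * C₀)), fun t ht => ?_⟩
  have h : ∫ x, ⟪G x, u t x⟫ = ∫ x, ⟪u t x, G x⟫ :=
    integral_congr_ae (ae_of_all _ fun x => real_inner_comm _ _)
  rw [h]
  exact impulseGrid_abs_integral_inner_le hu hK0 hK hC₀ ht

/-- The modal amplitude `t ↦ (G, u(t))` against a continuous field is interval integrable on every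
`[0, T]`. [folklore] -/
theorem intervalIntegrable_integral_inner (hu : IsGlobalLerayHopf ν (fun _ => f) u₀ u)
    (hG : Continuous G) {T : ℝ} (hT : 0 < T) :
    IntervalIntegrable (fun t => ∫ x, ⟪G x, u t x⟫) volume 0 T := by
  refine (GridInjection.intervalIntegrable_inner hu hG hT).congr fun t _ => ?_
  exact integral_congr_ae (ae_of_all _ fun x => real_inner_comm _ _)

/-- The product `t ↦ (G,u(t)) · ∫⟪u(t),(u(t)·∇)G⟫` of the bounded measurable amplitude with the
interval-integrable convective pairing is interval integrable on every `[0, T]`. [folklore] -/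
theorem intervalIntegrable_mul_convect (hf : IsSmooth f)
    (hu : IsGlobalLerayHopf ν (fun _ => f) u₀ u) (hG : IsSmooth G)
    (hE : ∃ C₀ : ℝ, ∀ t : ℝ, 0 ≤ t → kineticEnergy (u t) ≤ C₀) {T : ℝ} (hT : 0 < T) :
    IntervalIntegrable (fun t => (∫ x, ⟪G x, u t x⟫) * ∫ x, ⟪u t x, convect (u t) G x⟫)
      volume 0 T := by
  obtain ⟨M, hM⟩ := exists_abs_integral_inner_le hu hG.continuous hE
  have hX := intervalIntegrable_integral_inner hu hG.continuous hT
  have hTG := GridInjection.intervalIntegrable_inner_convect (hf.memLp 2) hu hG hT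
  rw [intervalIntegrable_iff_integrableOn_Ioc_of_le hT.le] at hX hTG ⊢
  refine hTG.bdd_mul (c := M) hX.aestronglyMeasurable ?_
  filter_upwards [ae_restrict_mem measurableSet_Ioc] with t ht
  rw [Real.norm_eq_abs]
  exact hM t ht.1.le

/-- The square `t ↦ (G,u(t))²` of the bounded amplitude has non-negative generalized long-time
average. [folklore] -/
theorem longTimeAvg_sq_nonneg (Λ : GeneralizedLimit)
    (hu : IsGlobalLerayHopf ν (fun _ => f) u₀ u) (hG : Continuous G)
    (hE : ∃ C₀ : ℝ, ∀ t : ℝ, 0 ≤ t → kineticEnergy (u t) ≤ C₀) :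
    0 ≤ Λ.longTimeAvg (fun t => (∫ x, ⟪G x, u t x⟫) ^ 2) := by
  obtain ⟨M, hM⟩ := exists_abs_integral_inner_le hu hG hE
  refine Λ.longTimeAvg_nonneg (fun t => sq_nonneg _) (C := M ^ 2) fun t ht => ?_
  rw [abs_pow]
  exact pow_le_pow_left₀ (abs_nonneg _) (hM t ht.le) 2

end AcWorkOfQuadratureDrag

/-- **Stub W4 of the line `Sketch` (crux `GridThesis`)**: AC work from AC eddy drag on a
quadrature pair. Given the α-balance (first hypothesis, the neighbouring stub
`stub_alphaBalance`): for a quadrature pair of smooth divergence-free Stokes eigenfields `C, S`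
with the same eigenvalue `μ`, `νμ ≥ 0`, `(f,C) = κ > 0`, `(f,S) = 0`, and AC eddy drag
`Λ⟨X·T_C(u) + Y·T_S(u)⟩ ≤ −δ` (`X = (C,u)`, `Y = (S,u)`), one has `Λ⟨X⟩ ≥ δ/κ`: sum the two
balances, `κΛ⟨X⟩ = νμ(Λ⟨X²⟩ + Λ⟨Y²⟩) − Λ⟨X·T_C + Y·T_S⟩ ≥ δ`. [folklore] -/
theorem stub_acWorkOfQuadratureDrag :
    ∀ (Λ : GeneralizedLimit) (ν μ κ δ : ℝ)
      (f C S u₀ : UnitAddTorus (Fin 3) → EuclideanSpace ℝ (Fin 3))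
      (u : ℝ → UnitAddTorus (Fin 3) → EuclideanSpace ℝ (Fin 3)),
      (∀ (Λ : GeneralizedLimit) (ν lam : ℝ)
          (f G u₀ : UnitAddTorus (Fin 3) → EuclideanSpace ℝ (Fin 3))
          (u : ℝ → UnitAddTorus (Fin 3) → EuclideanSpace ℝ (Fin 3)),
        IsSmooth f → IsSmooth G → IsDivFree G →
        (∀ x, laplacian G x = -(lam • G x)) →
        IsGlobalLerayHopf ν (fun _ => f) u₀ u →
        (∃ C : ℝ, ∀ t : ℝ, 0 ≤ t → kineticEnergy (u t) ≤ C) →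
        (∫ x, ⟪f x, G x⟫) * Λ.longTimeAvg (fun t => ∫ x, ⟪G x, u t x⟫) =
          ν * lam * Λ.longTimeAvg (fun t => (∫ x, ⟪G x, u t x⟫) ^ 2) -
            Λ.longTimeAvg (fun t => (∫ x, ⟪G x, u t x⟫) * ∫ x, ⟪u t x, convect (u t) G x⟫)) →
      IsSmooth f → IsSmooth C → IsSmooth S → IsDivFree C → IsDivFree S →
      (∀ x, laplacian C x = -(μ • C x)) → (∀ x, laplacian S x = -(μ • S x)) → 0 ≤ ν * μ →
      (∫ x, ⟪f x, C x⟫ = κ) → 0 < κ → (∫ x, ⟪f x, S x⟫ = 0) →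
      IsGlobalLerayHopf ν (fun _ => f) u₀ u →
      (∃ C₀ : ℝ, ∀ t : ℝ, 0 ≤ t → kineticEnergy (u t) ≤ C₀) →
      Λ.longTimeAvg (fun t =>
        (∫ x, ⟪C x, u t x⟫) * (∫ x, ⟪u t x, convect (u t) C x⟫) +
          (∫ x, ⟪S x, u t x⟫) * (∫ x, ⟪u t x, convect (u t) S x⟫)) ≤ -δ →
      δ / κ ≤ Λ.longTimeAvg (fun t => ∫ x, ⟪C x, u t x⟫) := by
  intro Λ ν μ κ δ f C S u₀ u hbal hf hC hS hCdiv hSdiv hΔC hΔS hνμ hfC hκ hfS hu hE hdrag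
  -- the two α-balances, at `C` and at `S`
  have h1 := hbal Λ ν μ f C u₀ u hf hC hCdiv hΔC hu hE
  have h2 := hbal Λ ν μ f S u₀ u hf hS hSdiv hΔS hu hE
  rw [hfC] at h1
  rw [hfS, zero_mul] at h2
  -- additivity of `Λ⟨·⟩` on the two interval-integrable products
  have hadd := GridInjection.longTimeAvg_add Λ
    (fun T hT => AcWorkOfQuadratureDrag.intervalIntegrable_mul_convect hf hu hC hE hT)
    (fun T hT => AcWorkOfQuadratureDrag.intervalIntegrable_mul_convect hf hu hS hE hT)
  -- positivity of `Λ⟨X²⟩`, `Λ⟨Y²⟩`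
  have hX2 := AcWorkOfQuadratureDrag.longTimeAvg_sq_nonneg Λ hu hC.continuous hE
  have hY2 := AcWorkOfQuadratureDrag.longTimeAvg_sq_nonneg Λ hu hS.continuous hE
  rw [hadd] at hdrag
  rw [div_le_iff₀ hκ]
  have hX2' := mul_nonneg hνμ hX2
  have hY2' := mul_nonneg hνμ hY2
  linarith

end Summit.AnomalousDissipation.AnomalousDissipation.Theorems

end
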